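import Summits.HubbardSuperconductivity.HubbardSuperconductivity.Theorems.AnisotropyChordTransferTolerance
import Summits.HubbardSuperconductivity.HubbardSuperconductivity.Theorems.AnisotropyChordTransferCompressibilityResponse
import Summits.HubbardSuperconductivity.HubbardSuperconductivity.Theorems.AnisotropyChordTransferFerroEdge

/-!
# Theory seat `hubbard-h0-rotor-theory-1`, cycle 13 (g13) — Part N: THE RESIDUAL OF ROUTE (1) IN SPIN-WAVE COORDINATES
# (memo ROTOR-THEORY-13 §188–§191).
(Verbatim port of the theory seat `hubbard-h0-rotor-theory-1` file `cycle13/lean/PartN13.lean`, sha16 729da31694dc38ea, by the prover seat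
`hubbard-h0-rotor-p1` g18: tree namespace, linter option and docstring tags only; no new mathematics.)

Route (1) «anchor + transfer» is complete in the tree modulo ONE spectral input of Bogoliubov type (any of
`SymmetricSectorGap Δ c₁ (k+1)`, `K ∧ R₀`, `SymmetricSectorGapInvV Δ C (k+1)` with `C ≥ C₀`, `TowerFidelityDefect Δ δ₀ k`).
Linear spin-wave theory (LSW: Holstein–Primakoff + Bogoliubov about the in-plane ferromagnet, memo §188) evaluates every one of
these quantities in closed form and reproduces the exact-diagonalisation rows of kit job j320882 (4×4, 5×5, 6×4, 8×3; Δ = 0, 0.5)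
to 2–16 %.  Its predictions, recorded here as TYPED STATEMENTS (no new Hamiltonian analysis is claimed):

* the tower-fidelity defect VANISHES like `ln L / L²`:  `1 − F_j ≈ 2 Σ_{k≠0} (u_k v_k)² / (|V| m)²`,
  `(u_k v_k)² = (1−Δ)² γ_k² / (16 (1−Δγ_k)(1−γ_k))`, numerically `|V|(1 − F₀) ≤ 0.31 ln L` for `4 ≤ L ≤ 128` at `Δ = 0`
  (asymptotic constant `(1−Δ)/(4π m²)`).  The g12 reading «`1 − F` flat in `L`» (memo 12 §185 (iii)) compared tori of different
  SHAPES; on `L × L` tori LSW gives `6.5e-3, 5.9e-3, 4.8e-3, 3.2e-3` for `L = 4, 6, 8, 12`.  Hence the natural hypothesis is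
  `TowerFidelityVanishing` below (every `δ > 0`), of which the tree's tolerance theorem needs only `δ₀ = c₀/(k+1)`;
* the symmetric (`k = 0`) sector gap is the TWO-PHONON energy `2ω(k₁) = 4π c_s/L_max` (`c_s = √(1−Δ)` at `S = 1/2`, LSW), i.e.
  `SymmetricSectorGap Δ c₁ (k+1)` with `c₁ ≈ 4π√(1−Δ)` (ED: `g_sym·L = 10.4, 12.0, 12.8, 13.2` vs `4π = 12.57` at `Δ = 0`);
* at the isotropic edge `Δ = 1` the fidelity is EXACTLY `1` (SU(2): `S⁺ψ_j ∝ ψ_{j+1}`), so the tolerance hypothesis holds with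
  `δ = 0` where the gap hypothesis provably fails (`not_sectorGapAtLeast_at_one`): `TowerFidelityAtOne` below, provable from the
  tree's `perronAmplitude_at_one_uniform` (left to the prover seat);
* census item u1 (memo 12 §186): in the DILUTE sectors (two magnons) the `k = 0` Temple-form gap is `(4π² + o(1))/L²` for every
  `−0.5 ≤ Δ ≤ 1` (no `K = 0` bound state in `d = 2`; two-body Lanczos `L ≤ 32`, memo §189) — a `c₁/L` gap is a FINITE-DENSITY
  (phonon) effect, so any proof of (H2) must use the density: `DiluteSymGapUpper` below.

Statements only, plus bookkeeping corollaries of landed theorems.  Typing authority: theory seat; proofs of `TowerFidelityAtOne`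
and `DiluteSymGapUpper` are prover work (`--supports stmt-19089 --as helper`).
-/

set_option linter.dupNamespace false
set_option autoImplicit false

noncomputable section

open Finset Filter Topology
open Literature.MathematicalPhysics.QuantumLattice Literature.Probability.LatticeModels
open Summit.HubbardSuperconductivity.HubbardSuperconductivity.Theorems.AnisotropyChord.InsertionEntropy
open Summit.HubbardSuperconductivity.HubbardSuperconductivity.Theorems.AnisotropyChord.Transfer
open Summit.HubbardSuperconductivity.HubbardSuperconductivity.Theorems.AnisotropyChord.Tower

namespace Summit.HubbardSuperconductivity.HubbardSuperconductivity.Theorems.AnisotropyChord.Transfer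

/-- **CONJECTURE F→1 (tower fidelity VANISHES on the first `k` links):** for every `δ > 0`, eventually in `L`, `1 − F_j ≤ δ` for
`j < k`.  LSW value: `1 − F_j ≈ (1−Δ) ln L / (4π m² L²) → 0` (memo ROTOR-THEORY-13 §188(b)).
[conjecture: theory seat hubbard-h0-rotor-theory-1, cycle 13, memo §188 — OPEN (Bogoliubov class); implies the tree's
`TowerFidelityDefect Δ δ₀ k` for every `δ₀ > 0`] -/
def TowerFidelityVanishing (Δ : ℝ) (k : ℕ) : Prop :=
  ∀ δ : ℝ, 0 < δ → TowerFidelityDefect Δ δ k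

/-- **CONJECTURE F→1 AT THE LSW RATE `ln L / L²`:** eventually in `L`, `1 − F_j ≤ C ln L / L²` for `j < k`.
LSW: `C(Δ = 0) ∈ [0.08, 0.31]` for `4 ≤ L ≤ 128`, asymptotically `(1−Δ)/(4π m²) ≈ 0.41·(1−Δ)·(0.19/m²)`.
[conjecture: theory seat hubbard-h0-rotor-theory-1, cycle 13, memo §188(b) — OPEN; the sharp (spin-wave) form of F→1] -/
def TowerFidelityLogLaw (Δ C : ℝ) (k : ℕ) : Prop :=
  ∀ᶠ L : ℕ in atTop, ∀ [NeZero L], ∀ j : ℕ, j < k →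
    ∀ b a : TensorIndex (TorusSite 2 L) 2 → ℝ,
      IsPerronSectorGroundAmplitude L Δ (j : ℝ) b → IsPerronSectorGroundAmplitude L Δ ((j : ℝ) + 1) a →
        1 - towerFidelity b a ≤ C * Real.log L / (L : ℝ) ^ 2

/-- the `ln L / L²` law implies F→1. [folklore] -/
theorem towerFidelityVanishing_of_logLaw {Δ C : ℝ} {k : ℕ} (h : TowerFidelityLogLaw Δ C k) :
    TowerFidelityVanishing Δ k := by
  intro δ hδ
  have hT : ∀ᶠ L : ℕ in atTop, |C| / δ ≤ (L : ℝ) := tendsto_natCast_atTop_atTop.eventually_ge_atTop _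
  have h1 : ∀ᶠ L : ℕ in atTop, 1 ≤ L := eventually_ge_atTop 1
  filter_upwards [h, hT, h1] with L hL hLT hL1
  intro _ j hj b a hb ha
  have hmain := hL j hj b a hb ha
  have hL1' : (1 : ℝ) ≤ (L : ℝ) := by exact_mod_cast hL1
  have hLpos : (0 : ℝ) < (L : ℝ) := by linarith
  have hlog : Real.log L ≤ (L : ℝ) := (Real.log_le_sub_one_of_pos hLpos).trans (by linarith)
  have hlog0 : 0 ≤ Real.log L := Real.log_nonneg hL1'
  have hCL : |C| ≤ (L : ℝ) * δ := (div_le_iff₀ hδ).mp hLT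
  calc 1 - towerFidelity b a ≤ C * Real.log L / (L : ℝ) ^ 2 := hmain
    _ ≤ |C| * (L : ℝ) / (L : ℝ) ^ 2 := by
        apply div_le_div_of_nonneg_right _ (by positivity)
        calc C * Real.log L ≤ |C| * Real.log L := mul_le_mul_of_nonneg_right (le_abs_self C) hlog0
          _ ≤ |C| * (L : ℝ) := mul_le_mul_of_nonneg_left hlog (abs_nonneg C)
    _ = |C| / (L : ℝ) := by field_simp
    _ ≤ δ := by rw [div_le_iff₀ hLpos]; linarith

/-- **F→1 + anchor ⇒ BEC on the first `k` sectors** (take `δ = min(1/2, c₀/(2(k+1)))` in the tree's tolerance theorem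
`condensateOnFirstSectors_of_fidelityDefect`). [folklore] -/
theorem condensateOnFirstSectors_of_fidelityVanishing {Δ c₀ : ℝ} {k : ℕ} (hc₀ : 0 < c₀)
    (hA : HalfFillingAnchor Δ c₀) (hF : TowerFidelityVanishing Δ k) : CondensateOnFirstSectors Δ k := by
  have hk1 : (0 : ℝ) < (k : ℝ) + 1 := by positivity
  set δ : ℝ := min (1 / 2) (c₀ / (2 * ((k : ℝ) + 1))) with hδ
  have hδpos : 0 < δ := lt_min (by norm_num) (by positivity)
  have hδ1 : δ < 1 := lt_of_le_of_lt (min_le_left _ _) (by norm_num)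
  have hkδ : (k : ℝ) * δ < c₀ := by
    have h1 : δ ≤ c₀ / (2 * ((k : ℝ) + 1)) := min_le_right _ _
    have hk : (0 : ℝ) ≤ k := Nat.cast_nonneg _
    have h2 : (k : ℝ) * δ ≤ (k : ℝ) * (c₀ / (2 * ((k : ℝ) + 1))) := mul_le_mul_of_nonneg_left h1 hk
    have h3 : (k : ℝ) * (c₀ / (2 * ((k : ℝ) + 1))) < c₀ := by
      rw [mul_div_assoc', div_lt_iff₀ (by positivity)]; nlinarith
    exact lt_of_le_of_lt h2 h3
  exact condensateOnFirstSectors_of_fidelityDefect hc₀ hδpos.le hδ1 hkδ hA (hF δ hδpos)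

/-- **THE ISOTROPIC EDGE `Δ = 1`: tower fidelity is exactly `1`.**  For Perron amplitudes `b` (sector `j`) and `a` (sector
`j + 1`) of `H(1)`, `towerFidelity b a = 1`: both are uniform on their sectors (`perronAmplitude_at_one_uniform`) and `S⁺b` is
`(number of raisable sites)·u_b` times the indicator of the next sector, hence parallel to `a`.
[conjecture: theory seat hubbard-h0-rotor-theory-1, cycle 13, memo §188(c) — SU(2) ferromagnet, folklore; Lean proof `towerFidelityAtOne_holds` below] -/
def TowerFidelityAtOne : Prop :=
  ∀ (L : ℕ) [NeZero L] (j : ℕ) (b a : TensorIndex (TorusSite 2 L) 2 → ℝ),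
    IsPerronSectorGroundAmplitude L 1 (j : ℝ) b → IsPerronSectorGroundAmplitude L 1 ((j : ℝ) + 1) a →
      towerFidelity b a = 1

section FerroEdge
open Summit.HubbardSuperconductivity.HubbardSuperconductivity.Theorems.AnisotropyChord.Stiffness
open Summit.HubbardSuperconductivity.HubbardSuperconductivity.Theorems.AnisotropyChord.Stiffness.Doob

variable {L : ℕ} [NeZero L]

/-- raising a `0` to a `1` increases the number of ones by one. [folklore] -/
theorem occ_update_one {σ : TensorIndex (TorusSite 2 L) 2} {x : TorusSite 2 L} (hx : σ x = 0) :
    Exch.occ (Function.update σ x 1) = Exch.occ σ + 1 := by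
  rw [occ_eq_weight, occ_eq_weight]
  have h : ∀ z, ((Function.update σ x 1 z : Fin 2) : ℕ) = (σ z : ℕ) + if z = x then 1 else 0 := by
    intro z
    by_cases hz : z = x
    · subst hz; simp [hx]
    · simp [hz]
  simp_rw [h]
  rw [Finset.sum_add_distrib]
  simp

/-- **`TowerFidelityAtOne` HOLDS** (both Perron amplitudes are uniform on their sectors, `perronAmplitude_at_one_uniform`; `S⁺` of the
uniform amplitude of the sector with `W` ones is `(|V| − W + 1)·u` times the indicator of the sector with `W − 1` ones). [folklore] -/
theorem towerFidelityAtOne_holds : TowerFidelityAtOne := by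
  intro L _ j b a hb ha
  obtain ⟨Wb, ub, hMb, hWbL, hbσ⟩ := perronAmplitude_at_one_uniform (j : ℝ) b hb
  obtain ⟨Wa, ua, hMa, hWaL, haσ⟩ := perronAmplitude_at_one_uniform ((j : ℝ) + 1) a ha
  have hW : Wb = Wa + 1 := by
    have : (Wb : ℝ) = (Wa : ℝ) + 1 := by linarith
    exact_mod_cast this
  have hua : ua ≠ 0 := by
    intro h0
    have hz : ∑ σ, a σ ^ 2 = 0 := Finset.sum_eq_zero fun σ _ => by rw [haσ σ]; split_ifs <;> simp [h0]
    rw [ha.unit] at hz; exact one_ne_zero hz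
  have hub : ub ≠ 0 := by
    intro h0
    have hz : ∑ σ, b σ ^ 2 = 0 := Finset.sum_eq_zero fun σ _ => by rw [hbσ σ]; split_ifs <;> simp [h0]
    rw [hb.unit] at hz; exact one_ne_zero hz
  set lam : ℝ := ((Fintype.card (TorusSite 2 L) : ℝ) - Wa) * ub / ua with hlam
  -- `S⁺b = lam • a`
  have hraise : ∀ σ, raiseSum b σ = lam * a σ := by
    intro σ
    unfold raiseSum
    by_cases hocc : Exch.occ σ = Wa
    · have hterm : ∀ x, (if σ x = 0 then b (Function.update σ x 1) else 0) = if σ x = 0 then ub else 0 := by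
        intro x
        by_cases hx : σ x = 0
        · rw [if_pos hx, if_pos hx, hbσ, occ_update_one hx, hocc, hW]; simp
        · rw [if_neg hx, if_neg hx]
      rw [Finset.sum_congr rfl fun x _ => hterm x, Finset.sum_ite, Finset.sum_const_zero, add_zero, Finset.sum_const,
        nsmul_eq_mul]
      have hcard : ((univ.filter fun x => σ x = 0).card : ℝ) = (Fintype.card (TorusSite 2 L) : ℝ) - Wa := by
        have h := card_holes_add_card_particles σ
        have hocc' : ((univ.filter fun y => σ y = 1).card : ℝ) = (Wa : ℝ) := by
          rw [← hocc]; simp [Exch.occ]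
        linarith
      rw [hcard, haσ σ, if_pos hocc, hlam]
      field_simp
    · have ha0 : a σ = 0 := by rw [haσ σ, if_neg hocc]
      rw [ha0, mul_zero]
      refine Finset.sum_eq_zero fun x _ => ?_
      by_cases hx : σ x = 0
      · have hne : Exch.occ (Function.update σ x 1) ≠ Wb := by
          rw [occ_update_one hx, hW]; intro h; exact hocc (by omega)
        rw [if_pos hx, hbσ, if_neg hne]
      · rw [if_neg hx]
  have hlam0 : lam ≠ 0 := by
    have hc : Fintype.card (TorusSite 2 L) = L ^ 2 := by rw [Fintype.card_fun, ZMod.card, Fintype.card_fin]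
    have hWa1 : Wa + 1 ≤ L ^ 2 := hW ▸ hWbL
    have hWa1' : (Wa : ℝ) + 1 ≤ ((L ^ 2 : ℕ) : ℝ) := by exact_mod_cast hWa1
    have hcardW : ((Fintype.card (TorusSite 2 L) : ℝ) - Wa) ≠ 0 := by
      rw [hc]; intro h0; linarith
    rw [hlam]; exact div_ne_zero (mul_ne_zero hcardW hub) hua
  have hts : towerSum b a = lam := by
    rw [towerSum_eq_raise]
    simp_rw [hraise]
    have : ∑ σ, lam * a σ * a σ = lam * ∑ σ, a σ ^ 2 := by
      rw [Finset.mul_sum]; exact Finset.sum_congr rfl fun σ _ => by ring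
    rw [this, ha.unit, mul_one]
  have hrn : raiseNormSq b = lam ^ 2 := by
    unfold raiseNormSq
    simp_rw [hraise]
    have : ∑ σ, (lam * a σ) ^ 2 = lam ^ 2 * ∑ σ, a σ ^ 2 := by
      rw [Finset.mul_sum]; exact Finset.sum_congr rfl fun σ _ => by ring
    rw [this, ha.unit, mul_one]
  unfold towerFidelity
  rw [hts, hrn, div_self (pow_ne_zero 2 hlam0)]

end FerroEdge

/-- at `Δ = 1` the tolerance hypothesis holds with defect `0` (hence with every `δ ≥ 0`), for every `k` — where the full-gap form
of (H2) provably fails (`not_sectorGapAtLeast_at_one`). [folklore] -/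
theorem towerFidelityDefect_at_one (h : TowerFidelityAtOne) {δ : ℝ} (hδ : 0 ≤ δ) (k : ℕ) : TowerFidelityDefect 1 δ k :=
  Filter.Eventually.of_forall fun L => by
    intro _ j _ b a hb ha
    rw [h L j b a hb ha]; linarith

/-- … so F→1 holds at `Δ = 1` in the strongest form. [folklore] -/
theorem towerFidelityVanishing_at_one (h : TowerFidelityAtOne) (k : ℕ) : TowerFidelityVanishing 1 k :=
  fun _ hδ => towerFidelityDefect_at_one h hδ.le k

/-- UNCONDITIONALLY: at `Δ = 1` the tree's tolerance hypothesis `TowerFidelityDefect 1 δ k` holds for every `δ ≥ 0` and every `k`. [folklore] -/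
theorem towerFidelityDefect_one {δ : ℝ} (hδ : 0 ≤ δ) (k : ℕ) : TowerFidelityDefect 1 δ k :=
  towerFidelityDefect_at_one towerFidelityAtOne_holds hδ k

/-- … and F→1 holds at `Δ = 1`. [folklore] -/
theorem towerFidelityVanishing_one (k : ℕ) : TowerFidelityVanishing 1 k :=
  towerFidelityVanishing_at_one towerFidelityAtOne_holds k

/-- **u1 — THE DILUTE OBSTRUCTION («density must enter»):** in the two-magnon sector `M = L²/2 − 2` every `k = 0` Temple-form
gap of `H(Δ)` is `≤ C/L²` eventually (two-body relative motion at total momentum `0`: lowest even scattering levels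
`−4 + O(1/(L² ln L))` and `−4 + 4π²/L² + …`, no `K = 0` bound state for `Δ ≤ 1` in `d = 2`; numerically `gap·L² → 4π²`, memo §189).
So no `c₁/L` symmetric gap holds uniformly over sectors: (H2) is a finite-density statement and its proof must use the density.
[conjecture: theory seat hubbard-h0-rotor-theory-1, cycle 13, memo §189 — PROVABLE (two-body min–max with an explicit even test
function); prover work, low priority] -/
def DiluteSymGapUpper (Δ C : ℝ) : Prop :=
  ∀ᶠ L : ℕ in atTop, ∀ [NeZero L], ∀ g : ℝ,
    SymGapAtLeast (L := L) Δ ((L : ℝ) ^ 2 / 2 - 2) g → g ≤ C / (L : ℝ) ^ 2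

end Summit.HubbardSuperconductivity.HubbardSuperconductivity.Theorems.AnisotropyChord.Transfer
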